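import Mathlib
import Literature.Analysis.Complex.PeriodicEntireLiouville
import Literature.MathematicalPhysics.QuantumFieldTheory.MirrorRPKernel
import HarnessLib

/-!
# Stub `stub_periodicTypeLiouville` (S3 · mode extinction) for the line `entire-profile-null-growth`

Crux `PrecisionLaplacian.StableConeRPRigidity` (stmt-CriticalPhenomena-4800), step S3: a
`T`-periodic entire function `G` with `‖G ω‖ ≤ C e^{β |im ω|}` and `β T < 2π` is constant. This
is the Literature theorem `Literature.Analysis.Complex.apply_eq_apply_of_periodic_of_norm_le_exp`
(Liouville for periodic entire functions of small exponential type, proved there via the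
line-independence of the Fourier–Laurent coefficient integrals, Fourier uniqueness on
`AddCircle T` and the identity theorem); the registered stub below is its verbatim restatement
(the hypothesis `0 ≤ β` of the registered text is not needed and is ignored).
-/

namespace Summit.CriticalPhenomena.Ising3DConformalLimit.Cruxes.StableConeRPRigidity.EntireProfileNullGrowth

/-- **S3 · Liouville for periodic entire functions of small exponential type (mode extinction).**
If `G : ℂ → ℂ` is entire, `T`-periodic (`T > 0`) and `‖G ω‖ ≤ C e^{β |im ω|}` with `β T < 2π`, then
`G` is constant. (Registered stub `stub_periodicTypeLiouville`, statement `PeriodicTypeLiouville`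
verbatim; proof = `Literature.Analysis.Complex.apply_eq_apply_of_periodic_of_norm_le_exp`.) -/
theorem stub_periodicTypeLiouville :
    ∀ (G : ℂ → ℂ) (T β C : ℝ), 0 < T → 0 ≤ β → β * T < 2 * Real.pi → Differentiable ℂ G →
      (∀ ω : ℂ, G (ω + T) = G ω) → (∀ ω : ℂ, ‖G ω‖ ≤ C * Real.exp (β * |ω.im|)) →
      ∀ z w : ℂ, G z = G w := by
  intro G T β C hT _hβ hβT hG hper hbound z w
  exact Literature.Analysis.Complex.apply_eq_apply_of_periodic_of_norm_le_exp hT hβT hG hper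
    hbound z w

end Summit.CriticalPhenomena.Ising3DConformalLimit.Cruxes.StableConeRPRigidity.EntireProfileNullGrowth
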